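import Mathlib
import Summits.NavierStokesRegularity.NavierStokesRegularity.Theorems.EulerZoomLiouvillePowerGaugeEulerLiouvilleNeedleAxisymSphere
import Literature.Analysis.FluidPDE.KNSSTypeIRateVertexCylinder

/-!
# Needle portrait, axisymmetric case: GOOD RADII AND THE THIN FAST TUBE (ROUND-37 plate t38j, part B)

Seat nsreg-p2 (`HOME/ns-regularity-ideate-p2/ROUND-37.md` §1 (K), v1.3); helper material for crux E
(`EulerZoomLiouville.PowerGaugeEulerLiouville`, stmt-NavierStokesRegularity-19832); nothing is wired into the
LEAD's skeleton.  This is the STRUCTURAL half of the discharge of the hypothesis `hthin` of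
`…NeedleRace.curl_eq_zero_of_thinFastExits` (ns-ezl-w2, ROUND-37 (R)) for an axisymmetric `C¹` profile `U`:

* `lintegral_sphereBudget_le_of_closedBall` — a budget `∫⁻_{|z| ≤ 2R} G ≤ ofReal(2π b)` of an axisymmetric scalar
  gives `∫⁻_{t ∈ (R,2R)} Φ_G(t) dt ≤ ofReal b` for the sphere budgets `Φ_G(t) = ∫⁻_θ ofReal(t² sin θ) G(p)` (t38d);
* `volume_bad_le`, `volume_good_ge` — Chebyshev in the radius (t38d `volume_setOf_sphereBudget_ge_le`): the
  radii with `Φ ≥ ofReal α`, `4b ≤ αR`, have measure `≤ R/4`, so the good radii in `(R,2R)` have measure `≥ R/2`;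
* `volume_image_sq_ge`, `measurableSet_image_sq` — the set `G` of SQUARES of good radii is measurable with
  `volume G ≥ 2R · volume(good) ≥ R²` (change of variables `t ↦ t²`);
* `axialTube L w = {‖z‖ ≤ L, cylRadius z ≤ w}`, `volume_axialTube_le` (`≤ 8Lw²`, t38a `volume_box_le`);
* `thinFastExits_structural` — for thresholds `α, β` and parameters `μ, Λ` with `4α ≤ μγ²R⁴`, `μ ≤ 2/5`,
  `1 ≤ Λ`, `4π(β + α/R²)Λ ≤ γ²R²`: there are `G ⊆ [R², 4R²]` (squares of good radii, `volume ≥ R²`) and the tube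
  `N = axialTube (2R) (2R√(2πμ)e^{−Λ})` such that every `γ`-fast `z` with `‖z‖² ∈ G` lies in `N`
  (Lemma K on the sphere, t38j-A `cylRadius_le_of_fast'`), with
  `volume N · ∫⁻_N ofReal ‖U‖² ≤ ofReal (16R·w²·2πb_A)`.

The asymptotic half (choice of `α, β, μ, Λ` from the class budgets `b_A = c_A(2R)^{1−2ρ}/(2π)`,
`b_E = c_E(2R)^{1−ρ}/(2π)`, giving `Λ ≍ γ²R^{2+ρ}` and the bound `≤ R^{−m}` for `R ≥ R₀(m)`) is part C.
Namespace `…PowerGaugeEulerLiouville.NeedleAxisymBand`, new names only.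
-/

open MeasureTheory Set Real intervalIntegral
open scoped ENNReal
open Literature.Analysis Literature.Analysis.FluidPDE
open Summit.NavierStokesRegularity.NavierStokesRegularity.Theorems.PowerGaugeEulerLiouville.NeedleSphericalTonelli

set_option linter.dupNamespace false

namespace Summit.NavierStokesRegularity.NavierStokesRegularity.Theorems.PowerGaugeEulerLiouville.NeedleAxisymBand

-- (the plate's `local notation "E3"` was spelled out at the gate by the firing seat: notation in Theorems files routes to review)

/-! ### 1. From a ball budget to the radius integral of the sphere budgets -/

/-- `∫⁻_{|z| ≤ 2R} G ≤ ofReal (2π b)` ⇒ `∫⁻_{t∈(R,2R)} Φ_G(t) ≤ ofReal b` for an axisymmetric scalar `G`. -/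
theorem lintegral_sphereBudget_le_of_closedBall {G : (EuclideanSpace ℝ (Fin 3)) → ℝ≥0∞} (hG : Measurable G)
    (hax : IsAxisymmetricScalar G) {R b : ℝ} (hR : 0 ≤ R)
    (hB : ∫⁻ z in Metric.closedBall (0 : (EuclideanSpace ℝ (Fin 3))) (2 * R), G z ≤ ENNReal.ofReal (2 * π * b)) :
    ∫⁻ t in Ioo R (2 * R), ∫⁻ θ in Ioo 0 π, ENNReal.ofReal (t ^ 2 * Real.sin θ) * G (sphericalPt t θ 0) ≤
      ENNReal.ofReal b := by
  have hshell := setLIntegral_shell_eq_spherical_of_axisymmetric hG hax hR (b := 2 * R)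
  have hsub : {x : (EuclideanSpace ℝ (Fin 3)) | R < ‖x‖ ∧ ‖x‖ < 2 * R} ⊆ Metric.closedBall (0 : (EuclideanSpace ℝ (Fin 3))) (2 * R) := by
    intro x hx
    rw [mem_closedBall_zero_iff]
    exact hx.2.le
  have h1 : ENNReal.ofReal (2 * π) * ∫⁻ t in Ioo R (2 * R), ∫⁻ θ in Ioo 0 π,
      ENNReal.ofReal (t ^ 2 * Real.sin θ) * G (sphericalPt t θ 0) ≤ ENNReal.ofReal (2 * π) * ENNReal.ofReal b := by
    rw [← hshell, ← ENNReal.ofReal_mul (by positivity)]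
    exact (lintegral_mono_set hsub).trans hB
  have h2π : ENNReal.ofReal (2 * π) ≠ 0 := (ENNReal.ofReal_pos.2 (by positivity)).ne'
  exact (ENNReal.mul_le_mul_iff_right h2π ENNReal.ofReal_ne_top).1 h1

/-! ### 2. Good radii -/

/-- Chebyshev in the radius: the radii in `(R,2R)` whose sphere budget is `≥ ofReal α` have measure `≤ R/4`
when `4b ≤ αR`. -/
theorem volume_bad_le {Φ : ℝ → ℝ≥0∞} (hΦ : Measurable Φ) {R b α : ℝ} (hα : 0 < α)
    (hαb : 4 * b ≤ α * R) (hB : ∫⁻ t in Ioo R (2 * R), Φ t ≤ ENNReal.ofReal b) :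
    volume ({t | ENNReal.ofReal α ≤ Φ t} ∩ Ioo R (2 * R)) ≤ ENNReal.ofReal (R / 4) := by
  have hε : ENNReal.ofReal α ≠ 0 := (ENNReal.ofReal_pos.2 hα).ne'
  refine (volume_setOf_sphereBudget_ge_le hΦ hB hε ENNReal.ofReal_ne_top).trans ?_
  rw [← ENNReal.ofReal_div_of_pos hα]
  refine ENNReal.ofReal_le_ofReal ?_
  rw [div_le_iff₀ hα]
  linarith

/-- The good radii `(R,2R) ∖ (bad_A ∪ bad_E)` have measure `≥ R/2`. -/
theorem volume_good_ge {badA badE : Set ℝ} {R : ℝ} (hR : 0 < R)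
    (hA : volume badA ≤ ENNReal.ofReal (R / 4)) (hE : volume badE ≤ ENNReal.ofReal (R / 4)) :
    ENNReal.ofReal (R / 2) ≤ volume (Ioo R (2 * R) \ (badA ∪ badE)) := by
  have hbad : volume (badA ∪ badE) ≤ ENNReal.ofReal (R / 2) := by
    refine (measure_union_le _ _).trans ?_
    rw [show R / 2 = R / 4 + R / 4 by ring, ENNReal.ofReal_add (by positivity) (by positivity)]
    exact add_le_add hA hE
  have hI : volume (Ioo R (2 * R)) = ENNReal.ofReal R := by
    rw [Real.volume_Ioo]; congr 1; ring
  calc ENNReal.ofReal (R / 2) = ENNReal.ofReal R - ENNReal.ofReal (R / 2) := by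
        rw [← ENNReal.ofReal_sub _ (by positivity)]; congr 1; ring
    _ ≤ volume (Ioo R (2 * R)) - volume (badA ∪ badE) := by
        rw [hI]; exact tsub_le_tsub_left hbad _
    _ ≤ volume (Ioo R (2 * R) \ (badA ∪ badE)) := le_measure_sdiff

/-! ### 3. Squares of good radii -/

/-- `t ↦ t²` is injective on `(0, ∞)`. [folklore] -/
theorem injOn_sq_Ioi : InjOn (fun t : ℝ => t ^ 2) (Ioi 0) := by
  intro x hx y hy h
  have h' := (sq_eq_sq_iff_abs_eq_abs x y).1 h
  rwa [abs_of_pos (mem_Ioi.1 hx), abs_of_pos (mem_Ioi.1 hy)] at h'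

/-- The image of a measurable `s ⊆ (0, ∞)` under `t ↦ t²` is measurable (injective continuous image). [folklore] -/
theorem measurableSet_image_sq {s : Set ℝ} (hs : MeasurableSet s) (hpos : s ⊆ Ioi 0) :
    MeasurableSet ((fun t : ℝ => t ^ 2) '' s) :=
  hs.image_of_continuousOn_injOn (continuous_pow 2).continuousOn (injOn_sq_Ioi.mono hpos)

/-- Change of variables `t ↦ t²` on `s ⊆ (R, ∞)`, `R > 0`: `volume (sq '' s) ≥ 2R · volume s`. -/
theorem volume_image_sq_ge {s : Set ℝ} (hs : MeasurableSet s) {R : ℝ} (hR : 0 < R) (hsR : s ⊆ Ioi R) :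
    ENNReal.ofReal (2 * R) * volume s ≤ volume ((fun t : ℝ => t ^ 2) '' s) := by
  have hpos : s ⊆ Ioi 0 := hsR.trans (Ioi_subset_Ioi hR.le)
  have hderiv : ∀ x ∈ s, HasDerivWithinAt (fun t : ℝ => t ^ 2) (2 * x) s x := by
    intro x _
    have h := (hasDerivAt_pow 2 x).hasDerivWithinAt (s := s)
    simpa using h
  have hcv := lintegral_image_eq_lintegral_abs_deriv_mul hs hderiv (injOn_sq_Ioi.mono hpos) (fun _ => 1)
  rw [setLIntegral_one] at hcv
  rw [hcv, ← setLIntegral_const]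
  refine setLIntegral_mono (by fun_prop) fun x hx => ?_
  rw [mul_one]
  refine ENNReal.ofReal_le_ofReal ?_
  have hxR : R < x := hsR hx
  rw [abs_of_pos (by linarith)]
  linarith

/-! ### 4. The axial tube -/

/-- The axial tube `{‖z‖ ≤ L, cylRadius z ≤ w}`. -/
def axialTube (L w : ℝ) : Set (EuclideanSpace ℝ (Fin 3)) := {z | ‖z‖ ≤ L ∧ cylRadius z ≤ w}

/-- The axial tube is measurable (closed conditions). [folklore] -/
theorem measurableSet_axialTube (L w : ℝ) : MeasurableSet (axialTube L w) :=
  (measurableSet_le continuous_norm.measurable measurable_const).inter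
    (measurableSet_le continuous_cylRadius.measurable measurable_const)

/-- The axial tube of length `L` lies in the closed ball of radius `L`. [folklore] -/
theorem axialTube_subset_closedBall (L w : ℝ) : axialTube L w ⊆ Metric.closedBall (0 : (EuclideanSpace ℝ (Fin 3))) L := by
  intro z hz
  rw [mem_closedBall_zero_iff]
  exact hz.1

-- `|z 0| ≤ cylRadius z`, `|z 1| ≤ cylRadius z` are the tree's `Literature.Analysis.FluidPDE.abs_apply_{zero,one}_le_cylRadius`
-- (…KNSSTypeIRateVertexCylinder); the plate's copies were removed at the gate (dedup) by the firing seat.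

/-- `volume (axialTube L w) ≤ 8 L w²` (the tube sits in the box `|z₀|,|z₁| ≤ w`, `|z₂| ≤ L`; t38a). -/
theorem volume_axialTube_le {L w : ℝ} (hw : 0 ≤ w) :
    volume (axialTube L w) ≤ ENNReal.ofReal (8 * L * w ^ 2) := by
  refine (measure_mono ?_).trans (volume_box_le (R := L) hw)
  intro z hz
  exact ⟨(abs_apply_zero_le_cylRadius z).trans hz.2, (abs_apply_one_le_cylRadius z).trans hz.2,
    (abs_apply_le_norm z 2).trans hz.1⟩

/-! ### 5. The structural thin-tube theorem -/

/-- `‖U‖ₑ²` is an axisymmetric scalar for axisymmetric `U`. -/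
theorem isAxisymmetricScalar_enorm_sq {U : (EuclideanSpace ℝ (Fin 3)) → (EuclideanSpace ℝ (Fin 3))} (hax : IsAxisymmetric U) :
    IsAxisymmetricScalar fun y => (‖U y‖ₑ : ℝ≥0∞) ^ 2 := by
  intro θ x
  have h := isAxisymmetricScalar_norm hax θ x
  simp only at h ⊢
  rw [← ofReal_norm, ← ofReal_norm, h]

/-- **Thin fast exits, structural form.**  `U` axisymmetric `C¹`; ball budgets `b_A`, `b_E` on `|z| ≤ 2R`;
thresholds `α, β` (`4b ≤ αR`, `4b_E ≤ βR`) and parameters `μ, Λ` of Lemma K.  Then the squares `G` of the good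
radii and the axial tube `N` of width `w = 2R√(2πμ)e^{−Λ}` have all the properties of `hthin`, with the size
`volume N · ∫⁻_N ofReal ‖U‖² ≤ ofReal (8(2R)w² · 2πb_A)`. -/
theorem thinFastExits_structural {U : (EuclideanSpace ℝ (Fin 3)) → (EuclideanSpace ℝ (Fin 3))} (hU : ContDiff ℝ 1 U) (hax : IsAxisymmetric U)
    {γ R bA bE α β μ Λ : ℝ} (hγ : 0 < γ) (hR : 0 < R) (hα : 0 < α) (hβ : 0 < β)
    (hIA : ∫⁻ z in Metric.closedBall (0 : (EuclideanSpace ℝ (Fin 3))) (2 * R), (‖U z‖ₑ : ℝ≥0∞) ^ 2 ≤ ENNReal.ofReal (2 * π * bA))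
    (hIE : ∫⁻ z in Metric.closedBall (0 : (EuclideanSpace ℝ (Fin 3))) (2 * R), (‖fderiv ℝ U z‖ₑ : ℝ≥0∞) ^ 2 ≤
      ENNReal.ofReal (2 * π * bE))
    (hαb : 4 * bA ≤ α * R) (hβb : 4 * bE ≤ β * R)
    (hμα : 4 * α ≤ μ * (γ ^ 2 * R ^ 4)) (hμ : μ ≤ 2 / 5) (hΛ1 : 1 ≤ Λ)
    (hΛβ : 4 * π * (β + α / R ^ 2) * Λ ≤ γ ^ 2 * R ^ 2) :
    ∃ (G : Set ℝ) (N : Set (EuclideanSpace ℝ (Fin 3))), MeasurableSet G ∧ G ⊆ Icc (R ^ 2) ((2 * R) ^ 2) ∧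
      1 * R ^ 2 ≤ (volume G).toReal ∧ MeasurableSet N ∧ N ⊆ Metric.closedBall 0 (2 * R) ∧
      (∀ z, ‖z‖ ^ 2 ∈ G → inner ℝ (U z) z + γ * ‖z‖ ^ 2 < 0 → z ∈ N) ∧
      volume N * ∫⁻ z in N, ENNReal.ofReal (‖U z‖ ^ 2) ≤
        ENNReal.ofReal (8 * (2 * R) * (2 * R * (Real.sqrt (2 * π * μ) * Real.exp (-Λ))) ^ 2 * (2 * π * bA)) := by
  -- the field and its derivative
  have hV : ∀ y, HasFDerivAt U (fderiv ℝ U y) y := fun y => (hU.differentiable one_ne_zero y).hasFDerivAt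
  have hV'c : Continuous (fderiv ℝ U) := hU.continuous_fderiv one_ne_zero
  have hUc : Continuous U := hU.continuous
  -- sphere budgets and their radius integrals
  set ΦA : ℝ → ℝ≥0∞ := fun t => ∫⁻ θ in Ioo 0 π, ENNReal.ofReal (t ^ 2 * Real.sin θ) *
    (‖U (sphericalPt t θ 0)‖ₑ : ℝ≥0∞) ^ 2 with hΦA
  set ΦE : ℝ → ℝ≥0∞ := fun t => ∫⁻ θ in Ioo 0 π, ENNReal.ofReal (t ^ 2 * Real.sin θ) *
    (‖fderiv ℝ U (sphericalPt t θ 0)‖ₑ : ℝ≥0∞) ^ 2 with hΦE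
  have hΦAm : Measurable ΦA := measurable_sphereBudget_enorm_sq hUc.measurable
  have hΦEm : Measurable ΦE := measurable_sphereBudget_enorm_sq hV'c.measurable
  have hIA' : ∫⁻ t in Ioo R (2 * R), ΦA t ≤ ENNReal.ofReal bA :=
    lintegral_sphereBudget_le_of_closedBall (hUc.measurable.enorm.pow_const 2)
      (isAxisymmetricScalar_enorm_sq hax) hR.le hIA
  have hIE' : ∫⁻ t in Ioo R (2 * R), ΦE t ≤ ENNReal.ofReal bE :=
    lintegral_sphereBudget_le_of_closedBall (hV'c.measurable.enorm.pow_const 2)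
      (isAxisymmetricScalar_enorm_fderiv_sq hax (hU.differentiable one_ne_zero)) hR.le hIE
  -- good radii
  set badA : Set ℝ := {t | ENNReal.ofReal α ≤ ΦA t} ∩ Ioo R (2 * R) with hbadA
  set badE : Set ℝ := {t | ENNReal.ofReal β ≤ ΦE t} ∩ Ioo R (2 * R) with hbadE
  set good : Set ℝ := Ioo R (2 * R) \ (badA ∪ badE) with hgood
  have hgoodm : MeasurableSet good :=
    measurableSet_Ioo.diff (((measurableSet_le measurable_const hΦAm).inter measurableSet_Ioo).union
      ((measurableSet_le measurable_const hΦEm).inter measurableSet_Ioo))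
  have hgoodvol : ENNReal.ofReal (R / 2) ≤ volume good :=
    volume_good_ge hR (volume_bad_le hΦAm hα hαb hIA') (volume_bad_le hΦEm hβ hβb hIE')
  have hgoodR : good ⊆ Ioi R := fun t ht => ht.1.1
  -- the tube width
  set w : ℝ := 2 * R * (Real.sqrt (2 * π * μ) * Real.exp (-Λ)) with hw
  have hw0 : 0 ≤ w := by positivity
  refine ⟨(fun t : ℝ => t ^ 2) '' good, axialTube (2 * R) w, measurableSet_image_sq hgoodm
    (hgoodR.trans (Ioi_subset_Ioi hR.le)), ?_, ?_, measurableSet_axialTube _ _,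
    axialTube_subset_closedBall _ _, ?_, ?_⟩
  · -- G ⊆ [R², (2R)²]
    rintro s ⟨t, ht, rfl⟩
    have h1 : R < t := ht.1.1
    have h2 : t < 2 * R := ht.1.2
    exact ⟨pow_le_pow_left₀ hR.le h1.le 2, pow_le_pow_left₀ (by linarith) h2.le 2⟩
  · -- volume G ≥ R²
    have hfin : volume ((fun t : ℝ => t ^ 2) '' good) ≠ ⊤ := by
      refine (lt_of_le_of_lt (measure_mono ?_) (measure_Icc_lt_top (a := R ^ 2) (b := (2 * R) ^ 2))).ne
      rintro s ⟨t, ht, rfl⟩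
      exact ⟨pow_le_pow_left₀ hR.le (le_of_lt ht.1.1) 2, pow_le_pow_left₀ (by linarith [ht.1.1]) ht.1.2.le 2⟩
    rw [one_mul, ← ENNReal.ofReal_le_iff_le_toReal hfin]
    calc ENNReal.ofReal (R ^ 2) = ENNReal.ofReal (2 * R) * ENNReal.ofReal (R / 2) := by
          rw [← ENNReal.ofReal_mul (by positivity)]; congr 1; ring
      _ ≤ ENNReal.ofReal (2 * R) * volume good := mul_le_mul' le_rfl hgoodvol
      _ ≤ volume ((fun t : ℝ => t ^ 2) '' good) := volume_image_sq_ge hgoodm hR hgoodR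
  · -- fast points with ‖z‖² ∈ G lie in the tube
    rintro z ⟨t, ht, hts⟩ hfast
    have h1 : R < t := ht.1.1
    have h2 : t < 2 * R := ht.1.2
    have ht0 : 0 < t := hR.trans h1
    have hzt : ‖z‖ = t := by
      have := (sq_eq_sq_iff_abs_eq_abs t ‖z‖).1 hts
      rwa [abs_of_pos ht0, abs_of_nonneg (norm_nonneg _), eq_comm] at this
    -- the two sphere budgets at the good radius `t`
    have hnotA : ¬ ENNReal.ofReal α ≤ ΦA t := fun h => ht.2 (Or.inl ⟨h, ht.1⟩)
    have hnotE : ¬ ENNReal.ofReal β ≤ ΦE t := fun h => ht.2 (Or.inr ⟨h, ht.1⟩)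
    have hAt : t ^ 2 * ∫ θ in (0 : ℝ)..π, ‖U (sphericalPt t θ 0)‖ ^ 2 * Real.sin θ ≤ α := by
      have := integral_sphere_le_of_lintegral_le hUc (ENNReal.ofReal_ne_top) (not_le.1 hnotA).le
      rwa [ENNReal.toReal_ofReal hα.le] at this
    have hEt : t ^ 2 * ∫ θ in (0 : ℝ)..π, ‖fderiv ℝ U (sphericalPt t θ 0)‖ ^ 2 * Real.sin θ ≤ β := by
      have := integral_sphere_le_of_lintegral_le hV'c (ENNReal.ofReal_ne_top) (not_le.1 hnotE).le
      rwa [ENNReal.toReal_ofReal hβ.le] at this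
    have ht2 : 0 < t ^ 2 := by positivity
    have hA : ∫ θ in (0 : ℝ)..π, ‖U (sphericalPt t θ 0)‖ ^ 2 * Real.sin θ ≤ α / t ^ 2 := by
      rw [le_div_iff₀ ht2]; linarith
    have hE : ∫ θ in (0 : ℝ)..π, ‖fderiv ℝ U (sphericalPt t θ 0)‖ ^ 2 * Real.sin θ ≤ β / t ^ 2 := by
      rw [le_div_iff₀ ht2]; linarith
    -- parameters of Lemma K at radius t
    have hRt2 : R ^ 2 ≤ t ^ 2 := pow_le_pow_left₀ hR.le h1.le 2
    have hμ0 : 0 ≤ μ := by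
      have : 0 < γ ^ 2 * R ^ 4 := by positivity
      nlinarith
    have hμA : 4 * (α / t ^ 2) ≤ μ * (γ ^ 2 * t ^ 2) := by
      rw [show 4 * (α / t ^ 2) = 4 * α / t ^ 2 by ring, div_le_iff₀ ht2]
      have : μ * (γ ^ 2 * R ^ 4) ≤ μ * (γ ^ 2 * t ^ 2) * t ^ 2 := by
        rw [show μ * (γ ^ 2 * t ^ 2) * t ^ 2 = μ * (γ ^ 2 * (t ^ 2 * t ^ 2)) by ring,
          show R ^ 4 = R ^ 2 * R ^ 2 by ring]
        exact mul_le_mul_of_nonneg_left (mul_le_mul_of_nonneg_left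
          (mul_le_mul hRt2 hRt2 (sq_nonneg R) ht2.le) (sq_nonneg γ)) hμ0
      linarith
    have hΛD : 4 * π * (t ^ 2 * (β / t ^ 2) + α / t ^ 2) * Λ ≤ γ ^ 2 * t ^ 2 := by
      rw [mul_div_cancel₀ _ ht2.ne']
      have hαt : α / t ^ 2 ≤ α / R ^ 2 := div_le_div_of_nonneg_left hα.le (by positivity) hRt2
      have hΛ0 : 0 ≤ Λ := by linarith
      calc 4 * π * (β + α / t ^ 2) * Λ ≤ 4 * π * (β + α / R ^ 2) * Λ := by
            refine mul_le_mul_of_nonneg_right ?_ hΛ0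
            exact mul_le_mul_of_nonneg_left (by linarith) (by positivity)
        _ ≤ γ ^ 2 * R ^ 2 := hΛβ
        _ ≤ γ ^ 2 * t ^ 2 := mul_le_mul_of_nonneg_left hRt2 (sq_nonneg γ)
    have hcyl := cylRadius_le_of_fast' hV hV'c hax ht0 hγ hA hE hμA hμ hΛ1 hΛD hzt hfast
    refine ⟨by rw [hzt]; exact h2.le, hcyl.trans ?_⟩
    exact mul_le_mul_of_nonneg_right (by linarith) (by positivity)
  · -- size of the tube
    have hvol := volume_axialTube_le (L := 2 * R) hw0
    have hint : ∫⁻ z in axialTube (2 * R) w, ENNReal.ofReal (‖U z‖ ^ 2) ≤ ENNReal.ofReal (2 * π * bA) := by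
      refine le_trans ?_ ((lintegral_mono_set (axialTube_subset_closedBall (2 * R) w)).trans hIA)
      refine lintegral_mono fun z => ?_
      rw [← ofReal_norm, ENNReal.ofReal_pow (norm_nonneg _)]
    calc volume (axialTube (2 * R) w) * ∫⁻ z in axialTube (2 * R) w, ENNReal.ofReal (‖U z‖ ^ 2)
        ≤ ENNReal.ofReal (8 * (2 * R) * w ^ 2) * ENNReal.ofReal (2 * π * bA) := mul_le_mul' hvol hint
      _ = ENNReal.ofReal (8 * (2 * R) * w ^ 2 * (2 * π * bA)) := by
          rw [← ENNReal.ofReal_mul (by positivity)]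

end Summit.NavierStokesRegularity.NavierStokesRegularity.Theorems.PowerGaugeEulerLiouville.NeedleAxisymBand
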